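import Mathlib.Probability.Moments.Covariance
import Mathlib.Topology.ContinuousMap.Bounded.Basic
import Literature.MathematicalPhysics.QuantumFieldTheory.BalabanBanachStep
import Literature.MathematicalPhysics.QuantumFieldTheory.LatticeGaugeProofs
import Literature.MathematicalPhysics.QuantumLattice.WilsonFermionBlockAveraging
import Literature.MathematicalPhysics.QuantumLattice.LatticeTori
import Literature.MathematicalPhysics.QuantumLattice.HeatKernelGroupGaugeProofs
import Literature.Probability.LatticeModels.GibbsSpecificationTilted
import HarnessLib

/-!
# Bałaban's effective theories as block-field specifications (hypothesis structure)

`BalabanBlockSpecification G r M` is a HYPOTHESIS STRUCTURE refining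
`Literature.MathematicalPhysics.QuantumFieldTheory.BalabanBanachStep G r M` (same directory; data +
the properties consumers use, NO existence claim inside: inhabiting it refines the open crux
`BalabanStepParabolic` of route `ParabolicTrajectory` of `YangMills`). `BalabanBanachStep` realises the
effective unit-lattice theories `p = (g, y)` of the chart only through the smeared `n`-point
FUNCTIONAL `expect p S n σ f`; the Dobrushin–Shlosman / Kotecký–Preiss certificate machinery that the
line `trajectory-gap-scaling` (crux `LatticeGapOnTrajectory`, its `ClustersOn S (tube …) m`) wants to
run needs the effective theories as honest lattice field theories of the unit-lattice (block) gauge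
field: finite-window conditional probability kernels given the configuration outside (a
SPECIFICATION), their torus Gibbs measures, the block-averaging map relating consecutive levels, and a
dictionary from `expect` to expectations of block-field observables. This file posits exactly that.

Sources for the shape of the data: the complete renormalisation transformation
`(Tρ)(V) = ∫ dU δ(Ū V⁻¹) ρ(U)` with "any averaging operation satisfying several general properties"
[Balaban1988Convergent, p. 243, (0.1)], read as the push-forward of the level-`k` Gibbs measure to
the block field (Dimock's re-exposition on tori with `L` odd and centred blocks [Dimock2013, §2.1]);
the inductive description of the effective densities by convergent expansions in localized terms
with exponential decay in the size of the localization domains, preserved by `RT` ("the operation RT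
transforms the space with the index k into the space with the index k + 1")
[Balaban1988Convergent, p. 261–262, (2.41)–(2.42) and Thm. 1 with the second remark]; Gibbsian
specifications of an interaction with an a priori (here: Haar) measure [Georgii2011, Def. 2.9], tree
`gibbsSpecOfPotential` / `isSpecification_gibbsSpecOfPotential`; finite-volume mixing conditions
`SM(V, C, m)` / `SMT(V, n, α)` and their "effectiveness" (a condition on finitely many finite-volume
kernels with all boundary conditions implies strong mixing of all regular volumes), which are
continuous in the sup-norm of the finite-volume kernels and hence OPEN in a weighted norm on the
interaction [Martinelli1999, §2.3 Def. 2.3–2.4, §2.4 Def. 2.6, Thm. 2.7, Prop. 2.9];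
[DobrushinShlosman1985], [DobrushinShlosman1987] for the original constructive criteria. No theorem
of these sources is vendored here (the gauge-theory finite-size criterion is route item
`OneCertifiedCube.FiniteSizeCriterion`); they fix the TOPOLOGY in which clause (s4) is stated.

## Contents

1. Torus bookkeeping (unit lattice = discrete torus `Site 4 S = (ℤ/S)⁴` of Wave 0; translations are
   the tree's `torusEdgeShift` / `torusConfigShift`): the `ℓ^∞` torus diameter of a finite edge set
   (`torusEdgeDiam`, via the tree's `torusDist`), the edge set of a torus plaquette
   (`torusPlaquetteEdges`, `torusPlaquetteEdges_add`).
2. Interactions on a torus as families `Φ : Finset (Edge 4 S) → (GaugeConfig 4 S G →ᵇ ℝ)` of bounded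
   continuous terms; their Gibbsian specification w.r.t. product Haar measure
   `torusSpecOfPotential Φ := gibbsSpecOfPotential (haarProbability G) Φ (fun _ => univ) 1` (tree) and
   its torus Gibbs measure `torusGibbsOfPotential Φ := torusSpecOfPotential Φ univ 1` (the full-volume
   kernel; on a finite torus it is THE Gibbs measure of the specification, `torusGibbsOfPotential_mem`);
   Wilson's action as such an interaction, `wilsonTorusPotential r β S` (`β (N − Re tr ρ(U_q))` on the
   edge set of the plaquette `q`, `0` on every other edge set; adapted, gauge and translation
   invariant: `dependsOn_/wilsonTorusPotential_gaugeTransform/_translate`).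
3. `IsTimeCompact f` (`tsupport f ⊆ {|x⁰| ≤ 1/3}`; verbatim the predicate of the line's skeleton).
4. `BalabanBlockSpecification G r M extends BalabanBanachStep G r M` with four groups of fields:
   (B) admissible block-averaging maps `blockAvg S : GaugeConfig 4 (M S) G → GaugeConfig 4 S G`
   (measurable; gauge covariant for `g ↦ g ∘ torusBlockCorner M S`, the class of Bałaban's remark);
   (P) the effective interactions `potential p S` of every chart point on every torus — adapted
   (`Φ_A` depends on `U|_A`), gauge and translation invariant, uniformly QUASI-LOCAL on
   `chart ∩ {g ≥ γ}` for every `γ > 0` (`∑_{A ∋ e} e^{κ · diam A} ‖Φ_A‖ ≤ K(γ)`, one `κ = locRate > 0`,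
   uniformly in the torus; the interaction has size `∼ g⁻²`, so no bound holds down to `g = 0`),
   CONTINUOUS in `p` at every chart point with positive coupling in the same weighted norm, uniformly
   in the torus (s4), EQUAL TO WILSON'S interaction `wilsonTorusPotential r (betaOf g) S` at the Wilson
   points `(g, yW g)` (s3), and RG-COVARIANT at the level of torus Gibbs measures: the image of the
   torus Gibbs measure of `p` on `M S` sites under `blockAvg S` is the torus Gibbs measure of `F p` on
   `S` sites, for `p` in the chart with positive coupling (s2);
   (O) block representatives `obsAt p L s f y` of the smeared species (one bounded measurable function
   of the block field per block `y ∈ box 4 L` of the torus `2L+1`), uniformly bounded and uniformly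
   quasi-local around `y` with weight the local size of `f`, centred, and equal to the genuine centred
   smeared species `c g s · f(y) (s(τ_y Ũ) − ⟨s⟩)` at Wilson points;
   (F) the two-point FLUCTUATION DOMINATION (s1): for time-compact `f, f'` and integer separations
   `1 ≤ t ≤ T`, `expect p (2T+1) 2 σ [f, τ_t f']` differs from the covariance, under the torus Gibbs
   measure of `p`, of the block representatives `∑_y obsAt … f y` and `∑_y obsAt … (τ_t f') y` by at
   most `K e^{−fluctRate · t}`, uniformly on `chart ∩ {g ≥ γ}` and in `T ≥ T₁` — the quantifier shape of
   `ClustersOn`.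
5. API: `spec`/`gibbs` (the specification and torus Gibbs measure of a chart point), `obs`, `chart`;
   `isSpecification_torusSpecOfPotential`, `torusGibbsOfPotential_mem`, `isSpecification_spec`,
   `gibbs_mem_gibbsMeasures` (the posited kernels ARE specifications and `gibbs` their Gibbs measure);
   `sum_wilsonTorusPotential`, `hamiltonianIn_wilsonTorusPotential_univ`,
   `torusGibbsOfPotential_wilsonTorusPotential` (the torus Gibbs measure of Wilson's interaction IS
   Wave 0's `wilsonMeasure`); `spec_wilson`, `gibbs_wilson`, `gibbs_wilson_eq_wilsonMeasure`,
   `obs_wilson`, `expect_wilson_eq_integral_prod_obs` (at Wilson points the kernels, the measure, the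
   block representatives and `expect` are the tree's Wilson objects, and (s1) is an EXACT moment
   identity for every `n`); `gibbs_step'`, `expect_two_sub_cov_le'` ((s2), (s1) through `gibbs`/`obs`).

## Exact forms fixed here (the request left them to the implementer) and one deviation

* Specifications are indexed by the chart point AND the torus (`potential p S`), as the request says
  ("for every chart point … and every cube/torus of `S` unit sites"); they are GIBBSIAN for a bounded
  continuous interaction w.r.t. product Haar measure (so: Feller, non-null, and `IsSpecification` is a
  theorem, `isSpecification_spec`), which is the form in which Dobrushin–Shlosman-type finite-volume
  conditions are stated and in which Bałaban's effective actions (sums of localized analytic terms)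
  arrive; the "unique finite-volume torus Gibbs measure" is the full-volume kernel
  (`torusGibbsOfPotential_mem`). Quasi-locality and the (s4) topology are the weighted interaction
  norm `∑_{A ∋ e} e^{κ diam A} ‖Φ_A‖_∞` (uniform bound on `chart ∩ {g ≥ γ}` + continuity in `p` at chart
  points with `g > 0`, both uniform in the torus): finite-window kernel densities are Lipschitz in it
  uniformly in the boundary condition and the torus, so conditions on finitely many windows are open
  in it, and compactness of an arc of the chart (over a coupling window `[γ, γ'] ⊂ (0, δ]`) then yields
  a uniform tube on which they hold (the purpose stated in the request).
* (s2) is stated, as requested, at the level of MEASURES (`Measure.map (blockAvg S)` of the torus Gibbs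
  measure on `M S` sites = the torus Gibbs measure of `F p` on `S` sites), for `p ∈ (0, δ] × B̄_R` —
  where `expect_step` (4a) is imposed, minus the frozen slice `g = 0` (the block field of the `β = ∞`
  theory is deterministic and has no Gibbsian description w.r.t. Haar measure; nothing is asked there
  beyond `BalabanBanachStep`'s own clauses); the averaging map is DATA restricted only by
  measurability and gauge covariance [Balaban1988Convergent, p. 243]; block locality, hypercubic
  covariance and the parity of `M` are not imposed (cf. `GaugeCovariantBlockMap` of this directory).
* (s3) is equality of INTERACTIONS with `wilsonTorusPotential r (betaOf g) S` on every torus, for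
  `g ∈ (0, g₀]` exactly where `expect_wilson` (4b) is imposed.
* DEVIATION in (s1). The request asks that `expect p S n σ f` BE the expectation of "the corresponding
  block-smeared species" under the torus Gibbs measure of `p`. Read literally (block field smeared at
  unit resolution, exact, all `n` or even `n = 2`) this is inconsistent with the fields of
  `BalabanBanachStep` that it must refine: by (4b) `expect` at a Wilson point `p₀` is the family of
  moments of the FINE plaquette fields, by (4a) `expect (F p₀) S 2 σ (f, f) = expect p₀ (M S) 2 σ
  (f∘M⁻¹, f∘M⁻¹)` is, as a quadratic form in `f`, the covariance form of the fine species field on the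
  torus of `M S` sites — it resolves `f` at scale `M⁻¹` and has the rank of that field — whereas a
  covariance of block observables `∑_y f(y) O_y` under any measure on `G^{edges of the S-torus}` factors
  through `f|_{ℤ⁴}`; along an orbit the deficit compounds (`expect (F^j p₀)` resolves scale `M^{-j}`),
  and by the law of total covariance the honest relation between `expect (F^j p₀)` and the level-`j`
  block field `V = Ū^{(j)}` is `Cov(A, A') = Cov(E[A|V], E[A'|V]) + E[Cov(A, A'|V)]` with a
  FLUCTUATION term that no block-field theory carries. The structure therefore posits what the
  certificate argument needs and what Bałaban's technology supplies: block representatives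
  `obsAt p L s f y` (intended: `E[· | V]` of the part of the fine smeared species living over the block
  `y`, which carries the `M^{4j}` bookkeeping of the dimension-four smearing and is `O(1)`), uniformly
  bounded and uniformly quasi-local in the block field [Balaban1988Convergent, (2.41)–(2.42):
  localized expansions], and domination of the connected two-point function by their covariance up to
  `K e^{−fluctRate t}` — the conditional covariance given the block field decays exponentially in block
  units because the averaging constraint gives the fluctuation field a unit mass
  [Dimock2013, App. D with §2.4: "the averaging operator `a_k Q_kᵀ Q_k` supplies an effective mass";
  Balaban1984Propagators for gauge fields]. It is stated for TIME-COMPACT test functions at integer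
  separations only (for overlapping supports the fluctuation term contains the coinciding-point
  divergence of the dimension-four composite field and is not bounded uniformly along orbits — the same
  reason (4c) is restricted to off-diagonal tuples), with constants uniform on `chart ∩ {g ≥ γ}` for
  every `γ > 0` (not down to `g = 0`: at Wilson points the representatives carry the multiplicative
  renormalisations `c g s`, which for species of dimension `≠ 4` are unbounded as `g → 0⁺`; the tube of
  `ClustersOn` has `g ≥ γ > 0`). With an `SMT`-type bound for the torus Gibbs measures of the tube
  (the certificate) the consumer bounds the covariance term block by block (`obsAt_bound`: sup bound and
  oscillation decay with the local size of `f` as weight, summable over the torus uniformly) and (s1)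
  does the rest. Exact moment identities are kept where they are true: one-point functions
  (`obsAt_centred`) and the Wilson points (`obsAt_wilson`, `obs_wilson`).

## What is NOT here

No existence statement; no Dobrushin–Shlosman condition or theorem (route item); no claim about the
parity of `M`, about block locality of `blockAvg`, or about `n`-point functions with `n ≥ 3` away from
the Wilson points; nothing at coupling `g = 0` beyond `BalabanBanachStep`'s own clauses; no
infinite-volume (`ℤ⁴`) specification (the torus families and their uniformity in the torus are what
finite-size conditions consume; an infinite-volume limit is the consumer's construction).
-/

open scoped SchwartzMap BoundedContinuousFunction ProbabilityTheory
open _root_.MeasureTheory _root_.Filter _root_.Topology _root_.ProbabilityTheory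
open Literature.MathematicalPhysics.AQFT Literature.MathematicalPhysics.QuantumLattice
open Literature.Probability.LatticeModels

noncomputable section

namespace Literature.MathematicalPhysics.QuantumFieldTheory

/-! ### 1. Torus bookkeeping -/

section Torus

variable {S : ℕ} {G : Type*}

/-- The periodic `ℓ^∞` diameter of a finite set of torus edges (base points, tree `torusDist`):
`diam A = max_{e, e' ∈ A} dist_∞(e.1, e'.1)` (`Finset.sup`, so `0` for `A = ∅` — harmless: the weight
`e^{κ · 0} = 1` is the smallest one). It weights the quasi-locality norm of interactions below. [folklore] -/
def torusEdgeDiam (A : Finset (Edge 4 S)) : ℕ :=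
  A.sup fun e => A.sup fun e' => torusDist (Ls := fun _ : Fin 4 => S) e.1 e'.1

/-- The diameter of the empty edge set is `0`. [folklore] -/
@[simp] theorem torusEdgeDiam_empty : torusEdgeDiam (∅ : Finset (Edge 4 S)) = 0 := by
  simp [torusEdgeDiam]

/-- The diameter of a single edge is `0`. [folklore] -/
@[simp] theorem torusEdgeDiam_singleton (e : Edge 4 S) : torusEdgeDiam ({e} : Finset (Edge 4 S)) = 0 := by
  simp [torusEdgeDiam]

/-- The four edges `(x, i), (x + eᵢ, j), (x + eⱼ, i), (x, j)` of the torus plaquette `q = (x, i < j)`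
(the links read by Wave 0's `plaquetteHolonomy U x i j`). [cite: arXiv180301950, §2] -/
def torusPlaquetteEdges (q : Plaquette 4 S) : Finset (Edge 4 S) :=
  {(q.1, q.2.1.1), (q.1.shift q.2.1.1, q.2.1.2), (q.1.shift q.2.1.2, q.2.1.1), (q.1, q.2.1.2)}

/-- The first edge `(x, i)` of a plaquette belongs to its edge set (so no plaquette has an empty edge
set). [folklore] -/
theorem fst_mem_torusPlaquetteEdges (q : Plaquette 4 S) : (q.1, q.2.1.1) ∈ torusPlaquetteEdges q := by
  simp [torusPlaquetteEdges]

/-- The edge set of a plaquette is nonempty. [folklore] -/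
theorem torusPlaquetteEdges_nonempty (q : Plaquette 4 S) : (torusPlaquetteEdges q).Nonempty :=
  ⟨_, fst_mem_torusPlaquetteEdges q⟩

/-- Translating a plaquette by `v` translates its edge set (tree `torusEdgeShift`). [folklore] -/
theorem torusPlaquetteEdges_add (q : Plaquette 4 S) (v : Site 4 S) :
    torusPlaquetteEdges ((q.1 + v, q.2) : Plaquette 4 S) =
      (torusPlaquetteEdges q).map (torusEdgeShift v).toEmbedding := by
  simp only [torusPlaquetteEdges, Finset.map_insert, Finset.map_singleton, Equiv.toEmbedding_apply,
    torusEdgeShift_apply, Site.shift, add_right_comm _ v]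

/-- The edge set of `q` is the translate by `v` of the edge set of `q − v`. [folklore] -/
theorem torusPlaquetteEdges_eq_map_sub (q : Plaquette 4 S) (v : Site 4 S) :
    torusPlaquetteEdges q =
      (torusPlaquetteEdges ((q.1 - v, q.2) : Plaquette 4 S)).map (torusEdgeShift v).toEmbedding := by
  have h := torusPlaquetteEdges_add ((q.1 - v, q.2) : Plaquette 4 S) v
  simpa only [sub_add_cancel, Prod.mk.eta] using h

end Torus

/-! ### 2. Interactions on a torus, their Gibbsian specification, Wilson's interaction -/

section Interaction

variable {G : Type*} [Group G] [TopologicalSpace G] [IsTopologicalGroup G] [CompactSpace G]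

section Spec

variable [MeasurableSpace G] [BorelSpace G]

/-- **The Gibbsian specification of a bounded continuous interaction on the torus of `S` sites**,
with product Haar measure as a priori measure: `γ_Λ(dU | η) = Z_Λ(η)⁻¹ exp(−∑_{A ∩ Λ ≠ ∅} Φ_A(U))
∏_{e ∈ Λ} dHaar(U_e) ⊗ δ_{η off Λ}` — the tree's `gibbsSpecOfPotential` at `β = 1` with every
interaction set allowed (`supp Λ = univ`; the torus is finite). These are the "conditional probability
kernels for the block gauge field inside a finite window given the configuration outside".
[cite: Georgii2011, Def. 2.9] -/
def torusSpecOfPotential {S : ℕ} [NeZero S] (Φ : Finset (Edge 4 S) → (GaugeConfig 4 S G →ᵇ ℝ)) :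
    Specification (Edge 4 S) G :=
  gibbsSpecOfPotential (haarProbability G) (fun A U => Φ A U) (fun _ => Finset.univ) 1

/-- **The torus Gibbs measure of the interaction `Φ`**: the full-volume kernel (boundary condition
irrelevant, taken `1`), i.e. `Z⁻¹ exp(−∑_A Φ_A(U)) ∏_e dHaar(U_e)` on `GaugeConfig 4 S G`. On the
finite torus this is the (unique) Gibbs measure of `torusSpecOfPotential Φ`
(`torusGibbsOfPotential_mem`). [cite: Georgii2011, Def. 2.9 with Def. 1.23] -/
def torusGibbsOfPotential {S : ℕ} [NeZero S] (Φ : Finset (Edge 4 S) → (GaugeConfig 4 S G →ᵇ ℝ)) :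
    Measure (GaugeConfig 4 S G) :=
  torusSpecOfPotential Φ Finset.univ 1

/-- Unfolding `torusGibbsOfPotential`. [folklore] -/
theorem torusGibbsOfPotential_def {S : ℕ} [NeZero S]
    (Φ : Finset (Edge 4 S) → (GaugeConfig 4 S G →ᵇ ℝ)) :
    torusGibbsOfPotential Φ = torusSpecOfPotential Φ Finset.univ 1 := rfl

end Spec

/-- **Wilson's action as an interaction on the torus**: the term of the edge set `A` is
`β ∑_{q : edges(q) = A} (N − Re tr ρ(U_q))` — `β (N − Re tr ρ(U_q))` when `A` is the edge set of the
plaquette `q`, `0` when `A` is no plaquette's edge set — so that `∑_A Φ_A = β S_W` (`sum_wilsonTorusPotential`).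
A bounded continuous function of the configuration (continuity of `ρ`, compactness of `G^{edges}`).
[cite: Wilson1974] [cite: SeilerLNP1982, Ch. 2 (the Wilson action with boundary terms as a finite-range interaction)] -/
def wilsonTorusPotential (r : LatticeRep G) (β : ℝ) (S : ℕ) [NeZero S] (A : Finset (Edge 4 S)) :
    GaugeConfig 4 S G →ᵇ ℝ :=
  BoundedContinuousFunction.mkOfCompact
    ⟨fun U => ∑ q ∈ Finset.univ.filter (fun q : Plaquette 4 S => torusPlaquetteEdges q = A),
        β * ((r.N : ℝ) - (r.ρ (plaquetteHolonomy U q.1 q.2.1.1 q.2.1.2)).trace.re),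
      continuous_finsetSum _ fun q _ => continuous_const.mul (continuous_const.sub
        (Complex.continuous_re.comp (r.continuous.comp (by unfold plaquetteHolonomy; fun_prop)).matrix_trace))⟩

/-- Unfolding `wilsonTorusPotential`. [folklore] -/
theorem wilsonTorusPotential_apply (r : LatticeRep G) (β : ℝ) (S : ℕ) [NeZero S]
    (A : Finset (Edge 4 S)) (U : GaugeConfig 4 S G) :
    wilsonTorusPotential r β S A U =
      ∑ q ∈ Finset.univ.filter (fun q : Plaquette 4 S => torusPlaquetteEdges q = A),
        β * ((r.N : ℝ) - (r.ρ (plaquetteHolonomy U q.1 q.2.1.1 q.2.1.2)).trace.re) := rfl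

/-- **The Wilson interaction sums to the Wilson action**: `∑_A Φ^W_A(U) = β S_W(U)` (each plaquette
is counted once, at its own edge set). [cite: Wilson1974] -/
theorem sum_wilsonTorusPotential (r : LatticeRep G) (β : ℝ) (S : ℕ) [NeZero S]
    (U : GaugeConfig 4 S G) :
    ∑ A : Finset (Edge 4 S), wilsonTorusPotential r β S A U = β * wilsonAction r.ρ U := by
  simp only [wilsonTorusPotential_apply]
  rw [Finset.sum_fiberwise Finset.univ (fun q : Plaquette 4 S => torusPlaquetteEdges q)
      (fun q => β * ((r.N : ℝ) - (r.ρ (plaquetteHolonomy U q.1 q.2.1.1 q.2.1.2)).trace.re)),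
    wilsonAction, Finset.mul_sum]

/-- The Wilson interaction vanishes on the empty edge set (every plaquette has an edge). [folklore] -/
theorem wilsonTorusPotential_empty (r : LatticeRep G) (β : ℝ) (S : ℕ) [NeZero S]
    (U : GaugeConfig 4 S G) : wilsonTorusPotential r β S ∅ U = 0 := by
  rw [wilsonTorusPotential_apply]
  refine Finset.sum_eq_zero fun q hq => ?_
  exact absurd (Finset.mem_filter.1 hq).2 (torusPlaquetteEdges_nonempty q).ne_empty

/-- The Wilson term of `A` depends only on the links in `A` (it is a function of the holonomies of
the plaquettes whose edge set is `A`). [cite: SeilerLNP1982, Ch. 2 (the Wilson action with boundary terms as a finite-range interaction)] -/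
theorem dependsOn_wilsonTorusPotential (r : LatticeRep G) (β : ℝ) (S : ℕ) [NeZero S]
    (A : Finset (Edge 4 S)) :
    DependsOn (fun U : GaugeConfig 4 S G => wilsonTorusPotential r β S A U) (↑A : Set (Edge 4 S)) := by
  intro U V h
  simp only [wilsonTorusPotential_apply]
  refine Finset.sum_congr rfl fun q hq => ?_
  have hA : torusPlaquetteEdges q = A := (Finset.mem_filter.1 hq).2
  have h' : ∀ e ∈ torusPlaquetteEdges q, U e = V e := fun e he =>
    h e (Finset.mem_coe.2 (hA ▸ he))
  simp only [plaquetteHolonomy]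
  rw [h' _ (by simp [torusPlaquetteEdges]), h' (q.1.shift q.2.1.1, q.2.1.2) (by simp [torusPlaquetteEdges]),
    h' (q.1.shift q.2.1.2, q.2.1.1) (by simp [torusPlaquetteEdges]),
    h' (q.1, q.2.1.2) (by simp [torusPlaquetteEdges])]

/-- **Gauge invariance of the Wilson interaction terms** (the plaquette holonomy transforms by
conjugation, the trace is cyclic) — so (s3) is consistent with `potential_gaugeTransform`. [cite: Wilson1974] -/
theorem wilsonTorusPotential_gaugeTransform (r : LatticeRep G) (β : ℝ) (S : ℕ) [NeZero S]
    (A : Finset (Edge 4 S)) (g : Site 4 S → G) (U : GaugeConfig 4 S G) :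
    wilsonTorusPotential r β S A (gaugeTransform g U) = wilsonTorusPotential r β S A U := by
  simp only [wilsonTorusPotential_apply]
  refine Finset.sum_congr rfl fun q _ => ?_
  rw [plaquetteHolonomy_gaugeTransform, map_mul, map_mul, Matrix.trace_mul_cycle, ← map_mul,
    inv_mul_cancel, map_one, one_mul]

/-- **Translation invariance of the Wilson interaction**, `Φ^W_{A + v}(τ_v U) = Φ^W_A(U)` (tree
`torusEdgeShift`, `torusConfigShift`) — so (s3) is consistent with `potential_translate`. [cite: Wilson1974] -/
theorem wilsonTorusPotential_translate [MeasurableSpace G] (r : LatticeRep G) (β : ℝ) (S : ℕ)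
    [NeZero S] (A : Finset (Edge 4 S)) (v : Site 4 S) (U : GaugeConfig 4 S G) :
    wilsonTorusPotential r β S (A.map (torusEdgeShift v).toEmbedding) (torusConfigShift v U) =
      wilsonTorusPotential r β S A U := by
  simp only [wilsonTorusPotential_apply, Finset.sum_filter]
  refine Fintype.sum_equiv ((Equiv.subRight v).prodCongr (Equiv.refl _)) _ _ fun q => ?_
  have hq : ((Equiv.subRight v).prodCongr (Equiv.refl _)) q = ((q.1 - v, q.2) : Plaquette 4 S) := rfl
  have hedges : torusPlaquetteEdges q = A.map (torusEdgeShift v).toEmbedding ↔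
      torusPlaquetteEdges ((q.1 - v, q.2) : Plaquette 4 S) = A := by
    rw [torusPlaquetteEdges_eq_map_sub q v, Finset.map_inj]
  rw [hq, plaquetteHolonomy_torusConfigShift]
  by_cases h : torusPlaquetteEdges ((q.1 - v, q.2) : Plaquette 4 S) = A
  · rw [if_pos (hedges.2 h), if_pos h]
  · rw [if_neg (mt hedges.1 h), if_neg h]

/-- The full-volume energy of the Wilson interaction is `β S_W` (the empty edge set carries no
term, every other set is counted). [cite: Wilson1974] -/
theorem hamiltonianIn_wilsonTorusPotential_univ (r : LatticeRep G) (β : ℝ) (S : ℕ) [NeZero S]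
    (U : GaugeConfig 4 S G) :
    hamiltonianIn (fun A (U : GaugeConfig 4 S G) => wilsonTorusPotential r β S A U)
        (fun _ => Finset.univ) Finset.univ U = β * wilsonAction r.ρ U := by
  classical
  unfold hamiltonianIn
  rw [Finset.sum_filter_of_ne fun A _ hA => ?_, sum_wilsonTorusPotential]
  rw [Finset.inter_univ]
  refine Finset.nonempty_iff_ne_empty.2 fun h => hA ?_
  subst h
  exact wilsonTorusPotential_empty r β S U

end Interaction

/-! ### 3. Time-compact test functions -/

/-- **Time-compact test functions**: support in the slab `|x⁰| ≤ 1/3` (verbatim the predicate of the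
line `trajectory-gap-scaling`: after an integer time shift `t ≥ 1` two such slabs are `≥ 1/3` apart,
so the two-point tuples of `ClustersOn` are off-diagonal; with Schwartz tails in time a fixed
exponential clustering rate would be false by transfer-matrix positivity). [folklore] -/
def IsTimeCompact (f : 𝓢(EuclideanSpace ℝ (Fin 4), ℝ)) : Prop :=
  tsupport (f : EuclideanSpace ℝ (Fin 4) → ℝ) ⊆ {x | |x 0| ≤ 1 / 3}

/-- The zero test function is time-compact. [folklore] -/
theorem isTimeCompact_zero : IsTimeCompact 0 := by
  intro x hx
  simp [tsupport, Function.support] at hx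

/-! ### 4. The hypothesis structure -/

/-- **Bałaban's effective theories as block-field specifications** — HYPOTHESIS STRUCTURE refining
`BalabanBanachStep G r M` (which it extends) by the data a Dobrushin–Shlosman-type finite-volume
certificate consumes; no existence claim inside. For every chart point `p = (g, y)` and every torus
of `S` unit sites it posits a bounded continuous, adapted, gauge- and translation-invariant
INTERACTION `potential p S` of the unit-lattice (block) gauge field, whose Gibbsian specification
w.r.t. product Haar measure (`spec`, tree `gibbsSpecOfPotential`) is the family of finite-window
conditional kernels of the effective theory and whose full-volume kernel is its torus Gibbs measure
(`gibbs`); the interactions are uniformly quasi-local (`∑_{A ∋ e} e^{locRate · diam A} ‖Φ_A‖ ≤ K(γ)`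
on `chart ∩ {g ≥ γ}`, all tori; the size is `∼ g⁻²`) and (s4) continuous in `p` at every chart point
with positive coupling in that weighted norm, uniformly in the torus — a topology in which conditions
on finitely many finite-window kernels with all boundary conditions are open [Martinelli1999, §2.4
Thm. 2.7 and Prop. 2.9] [DobrushinShlosman1985] [DobrushinShlosman1987];
(s3) at the Wilson points `(g, yW g)`, `g ∈ (0, g₀]`, the interaction IS Wilson's,
`wilsonTorusPotential r (betaOf g) S`; (s2) exact RG covariance at the level of measures: admissible
(measurable, gauge-covariant) block-averaging maps `blockAvg S` from the torus of `M S` sites to the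
torus of `S` sites push the torus Gibbs measure of `p` forward to that of `F p = (φ g y, Ψ g y)`, for
`p ∈ (0, δ] × B̄_R` [Balaban1988Convergent, p. 243 (0.1)] [Dimock2013, §2.1]; (s1) block
representatives `obsAt p L s f y` of the smeared species over the blocks `y ∈ box 4 L` of the torus
`2L+1` — measurable, uniformly bounded and uniformly quasi-local around `y` with the local size of `f`
as weight (on `chart ∩ {g ≥ γ}`), centred under the torus Gibbs measure, equal to the genuine centred
smeared species at Wilson points — and DOMINATION of the connected two-point function
`expect p (2T+1) 2 σ [f, τ_t f']` (time-compact `f, f'`, `1 ≤ t ≤ T`, `T ≥ T₁`) by the covariance of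
the representatives under the torus Gibbs measure up to a fluctuation remainder `K e^{−fluctRate · t}`
[Balaban1988Convergent, (2.41)–(2.42)] [Dimock2013, App. D] [Balaban1984Propagators, §1]. See the
module docstring for why (s1) is a domination and not the literal moment identity of the request (the
literal form contradicts (4a)/(4b) of `BalabanBanachStep`), and for what is deliberately not imposed.
[cite: Balaban1988Convergent, p. 243 (0.1) and p. 261–262 (2.41)–(2.42), Thm. 1 with the second remark] [cite: Dimock2013, §2.1 and App. D] [cite: Georgii2011, Def. 2.9] [cite: Martinelli1999, §2.3–2.4 (Def. 2.3, 2.4, 2.6; Thm. 2.7; Prop. 2.9)] -/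
structure BalabanBlockSpecification (G : Type) [Group G] [TopologicalSpace G] [IsTopologicalGroup G]
    [CompactSpace G] [MeasurableSpace G] [BorelSpace G] (r : LatticeRep G) (M : ℕ)
    extends BalabanBanachStep G r M where
  /-- (B) The block-averaging map from the unit-lattice gauge field on the torus of `M S` sites to
  the block field on the torus of `S` sites (one per coarse torus). -/
  blockAvg : (S : ℕ) → GaugeConfig 4 (M * S) G → GaugeConfig 4 S G
  measurable_blockAvg : ∀ S : ℕ, Measurable (blockAvg S)
  /-- Admissibility: a fine gauge transformation `g` acts on the block field as the coarse gauge
  transformation `g ∘ (y ↦ M y)`. -/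
  blockAvg_gaugeTransform : ∀ (S : ℕ) [NeZero S] (g : Site 4 (M * S) → G)
    (U : GaugeConfig 4 (M * S) G),
    blockAvg S (gaugeTransform g U) = gaugeTransform (g ∘ torusBlockCorner M S) (blockAvg S U)
  /-- (P) The effective interaction of the chart point `p` on the torus of `S` sites: one bounded
  continuous term per finite set of links. -/
  potential : ℝ × E → (S : ℕ) → Finset (Edge 4 S) → (GaugeConfig 4 S G →ᵇ ℝ)
  /-- Adaptedness: `Φ_A(U)` depends only on `U|_A`. -/
  potential_dependsOn : ∀ (p : ℝ × E) (S : ℕ) (A : Finset (Edge 4 S)),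
    DependsOn (fun U : GaugeConfig 4 S G => potential p S A U) (↑A : Set (Edge 4 S))
  /-- Gauge invariance of every interaction term. -/
  potential_gaugeTransform : ∀ (p : ℝ × E) (S : ℕ) (A : Finset (Edge 4 S)) (g : Site 4 S → G)
    (U : GaugeConfig 4 S G), potential p S A (gaugeTransform g U) = potential p S A U
  /-- Translation invariance of the interaction: `Φ_{A + v}(τ_v U) = Φ_A(U)` (tree `torusEdgeShift`,
  `torusConfigShift`). -/
  potential_translate : ∀ (p : ℝ × E) (S : ℕ) (A : Finset (Edge 4 S)) (v : Site 4 S)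
    (U : GaugeConfig 4 S G),
    potential p S (A.map (torusEdgeShift v).toEmbedding) (torusConfigShift v U) = potential p S A U
  /-- Quasi-locality rate of the effective interactions (in unit-lattice = block units). -/
  locRate : ℝ
  locRate_pos : 0 < locRate
  /-- Uniform quasi-locality on `chart ∩ {g ≥ γ}`, all tori and links:
  `∑_{A ∋ e} e^{locRate · diam A} ‖Φ_A‖ ≤ K(γ)` (the interaction is of size `∼ g⁻²`, so no bound
  holds down to `g = 0`). -/
  potential_norm_le : ∀ γ : ℝ, 0 < γ → ∃ K : ℝ,
    ∀ p ∈ Set.Icc 0 δ ×ˢ Metric.closedBall (0 : E) R, γ ≤ p.1 → ∀ (S : ℕ) [NeZero S] (e : Edge 4 S),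
      ∑ A ∈ Finset.univ.filter (fun A : Finset (Edge 4 S) => e ∈ A),
        Real.exp (locRate * torusEdgeDiam A) * ‖potential p S A‖ ≤ K
  /-- (s4) Continuity of `p ↦ potential p S` at every chart point with positive coupling, in the
  weighted norm, uniformly in the torus and the link (equicontinuity in `S`). -/
  potential_equicontinuous : ∀ p₀ ∈ Set.Icc 0 δ ×ˢ Metric.closedBall (0 : E) R, 0 < p₀.1 →
    ∀ ε : ℝ, 0 < ε → ∃ ρ : ℝ, 0 < ρ ∧ ∀ p ∈ Set.Icc 0 δ ×ˢ Metric.closedBall (0 : E) R,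
      dist p p₀ < ρ → ∀ (S : ℕ) [NeZero S] (e : Edge 4 S),
        ∑ A ∈ Finset.univ.filter (fun A : Finset (Edge 4 S) => e ∈ A),
          Real.exp (locRate * torusEdgeDiam A) * ‖potential p S A - potential p₀ S A‖ ≤ ε
  /-- (s3) At the Wilson points the effective interaction IS Wilson's at inverse coupling `β(g)`. -/
  potential_wilson : ∀ g ∈ Set.Ioc 0 g₀, ∀ (S : ℕ) [NeZero S],
    potential (g, yW g) S = wilsonTorusPotential r (betaOf g) S
  /-- (s2) Exact RG covariance at the level of torus Gibbs measures: blocking the effective theory of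
  `p = (g, y)` on `M S` sites gives the effective theory of `F p` on `S` sites, for `p` in the chart
  with positive coupling (at `g = 0` the block field of the frozen theory is deterministic and no
  Gibbsian description is asked for). -/
  gibbs_step : ∀ (g : ℝ) (y : E), g ∈ Set.Ioc 0 δ → ‖y‖ ≤ R → ∀ (S : ℕ) [NeZero S] [NeZero (M * S)],
    (torusGibbsOfPotential (potential (g, y) (M * S))).map (blockAvg S) =
      torusGibbsOfPotential (potential (φ g y, Ψ g y) S)
  /-- (O) The block representative, over the block `y ∈ box 4 L` of the torus of `2L+1` sites, of the
  species `s` smeared with `f` in the effective theory `p`: a function of the block field. -/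
  obsAt : ℝ × E → (L : ℕ) → YMSpecies G → 𝓢(EuclideanSpace ℝ (Fin 4), ℝ) →
    Literature.Probability.LatticeModels.Site 4 → GaugeConfig 4 (2 * L + 1) G → ℝ
  measurable_obsAt : ∀ p L s f y, Measurable (obsAt p L s f y)
  /-- Quasi-locality rate of the block representatives. -/
  obsRate : ℝ
  obsRate_pos : 0 < obsRate
  /-- Uniform boundedness and quasi-locality of the block representatives on `chart ∩ {g ≥ γ}`, with
  the local size of `f` around `y` as weight: if `|f| ≤ C` on the ball of radius `2` about `y` then
  `|obsAt … y| ≤ B C`, and changing the block field only on links at torus distance `> ℓ` from `y`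
  changes `obsAt … y` by at most `B C e^{−obsRate ℓ}`. -/
  obsAt_bound : ∀ γ : ℝ, 0 < γ → ∀ s : YMSpecies G, ∃ B : ℝ,
    ∀ p ∈ Set.Icc 0 δ ×ˢ Metric.closedBall (0 : E) R, γ ≤ p.1 →
      ∀ (L : ℕ) (f : 𝓢(EuclideanSpace ℝ (Fin 4), ℝ)) (y : Literature.Probability.LatticeModels.Site 4)
        (C : ℝ), (∀ u ∈ Metric.closedBall (siteToE y) 2, |f u| ≤ C) →
        (∀ U, |obsAt p L s f y U| ≤ B * C) ∧
        ∀ (ℓ : ℕ) (U U' : GaugeConfig 4 (2 * L + 1) G),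
          (∀ e : Edge 4 (2 * L + 1),
            torusDist (Ls := fun _ : Fin 4 => 2 * L + 1) e.1 (Torus.proj (2 * L + 1) y) ≤ ℓ →
              U e = U' e) →
          |obsAt p L s f y U - obsAt p L s f y U'| ≤ B * C * Real.exp (-(obsRate * ℓ))
  /-- The block representatives are centred under the torus Gibbs measure (one-point functions of the
  centred species vanish exactly). -/
  obsAt_centred : ∀ p ∈ Set.Icc 0 δ ×ˢ Metric.closedBall (0 : E) R, 0 < p.1 → ∀ (L : ℕ) (s : YMSpecies G)
    (f : 𝓢(EuclideanSpace ℝ (Fin 4), ℝ)) (y : Literature.Probability.LatticeModels.Site 4),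
    ∫ U, obsAt p L s f y U ∂(torusGibbsOfPotential (potential p (2 * L + 1))) = 0
  /-- At the Wilson points the block representative over `y` is the genuine centred smeared species
  term `c g s · f(y) (s(τ_y Ũ) − ⟨s⟩_{β(g), 2L+1})` of `wilsonCentredSchwinger`. -/
  obsAt_wilson : ∀ g ∈ Set.Ioc 0 g₀, ∀ (L : ℕ) (s : YMSpecies G) (f : 𝓢(EuclideanSpace ℝ (Fin 4), ℝ))
    (y : Literature.Probability.LatticeModels.Site 4) (U : GaugeConfig 4 (2 * L + 1) G),
    obsAt (g, yW g) L s f y U =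
      c g s * (f (siteToE y) *
        (s.F (configShift (-y) (torusLift (2 * L + 1) U)) - wilsonTorusMean r.ρ (betaOf g) L s.F))
  /-- Decay rate of the fluctuation remainder (in block units of Euclidean time). -/
  fluctRate : ℝ
  fluctRate_pos : 0 < fluctRate
  /-- (s1) **Two-point fluctuation domination**: for time-compact `f, f'`, the connected two-point
  function of `expect` at separation `t` is the covariance of the block representatives under the
  torus Gibbs measure of `p`, up to `K e^{−fluctRate t}`, uniformly on `chart ∩ {g ≥ γ}`, all tori
  `2T+1 ≥ 2T₁+1` and `1 ≤ t ≤ T` (the quantifier shape of `ClustersOn`). -/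
  expect_two_sub_cov_le : ∀ γ : ℝ, 0 < γ → ∀ (σ : Fin 2 → YMSpecies G)
    (f f' : 𝓢(EuclideanSpace ℝ (Fin 4), ℝ)), IsTimeCompact f → IsTimeCompact f' →
    ∃ K : ℝ, ∃ T₁ : ℕ, ∀ p ∈ Set.Icc 0 δ ×ˢ Metric.closedBall (0 : E) R, γ ≤ p.1 →
      ∀ T : ℕ, T₁ ≤ T → ∀ t : ℕ, 1 ≤ t → t ≤ T →
        |expect p (2 * T + 1) 2 σ ![f, timeShiftTest 4 (t : ℝ) f'] -
          cov[fun U => ∑ y ∈ box 4 T, obsAt p T (σ 0) f y U,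
            fun U => ∑ y ∈ box 4 T, obsAt p T (σ 1) (timeShiftTest 4 (t : ℝ) f') y U;
            torusGibbsOfPotential (potential p (2 * T + 1))]| ≤ K * Real.exp (-(fluctRate * t))

namespace BalabanBlockSpecification

variable {G : Type} [Group G] [TopologicalSpace G] [IsTopologicalGroup G] [CompactSpace G]
  [MeasurableSpace G] [BorelSpace G] {r : LatticeRep G} {M : ℕ} (𝔅 : BalabanBlockSpecification G r M)

/-- The chart `[0, δ] × B̄_R` on which (4a), (4c), (s2), (s4), (s1) are stated. [folklore] -/
def chart : Set (ℝ × 𝔅.E) := Set.Icc 0 𝔅.δ ×ˢ Metric.closedBall (0 : 𝔅.E) 𝔅.R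

/-- Membership in the chart. [folklore] -/
theorem mem_chart_iff (p : ℝ × 𝔅.E) : p ∈ 𝔅.chart ↔ p.1 ∈ Set.Icc 0 𝔅.δ ∧ ‖p.2‖ ≤ 𝔅.R := by
  simp [chart, Set.mem_prod]

/-- **The block-field specification of the effective theory `p` on the torus of `S` sites**: the
Gibbsian specification of `potential p S` w.r.t. product Haar measure. [cite: Georgii2011, Def. 2.9] -/
def spec (p : ℝ × 𝔅.E) (S : ℕ) [NeZero S] : Specification (Edge 4 S) G :=
  torusSpecOfPotential (𝔅.potential p S)

/-- **The torus Gibbs measure of the effective theory `p` on the torus of `S` sites.** [cite: Georgii2011, Def. 2.9 with Def. 1.23] -/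
def gibbs (p : ℝ × 𝔅.E) (S : ℕ) [NeZero S] : Measure (GaugeConfig 4 S G) :=
  torusGibbsOfPotential (𝔅.potential p S)

/-- `gibbs` is the full-volume kernel of `spec`. [folklore] -/
theorem gibbs_eq_spec_univ (p : ℝ × 𝔅.E) (S : ℕ) [NeZero S] :
    𝔅.gibbs p S = 𝔅.spec p S Finset.univ 1 := rfl

/-- **The block representative of the smeared species** `s(f)` in the effective theory `p` on the
torus of `2L+1` sites: the sum of its block pieces over `box 4 L`. [folklore] -/
def obs (p : ℝ × 𝔅.E) (L : ℕ) (s : YMSpecies G) (f : 𝓢(EuclideanSpace ℝ (Fin 4), ℝ))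
    (U : GaugeConfig 4 (2 * L + 1) G) : ℝ :=
  ∑ y ∈ box 4 L, 𝔅.obsAt p L s f y U

/-- Unfolding `obs`. [folklore] -/
theorem obs_apply (p : ℝ × 𝔅.E) (L : ℕ) (s : YMSpecies G) (f : 𝓢(EuclideanSpace ℝ (Fin 4), ℝ))
    (U : GaugeConfig 4 (2 * L + 1) G) : 𝔅.obs p L s f U = ∑ y ∈ box 4 L, 𝔅.obsAt p L s f y U := rfl

/-- `obs` is measurable. [folklore] -/
theorem measurable_obs (p : ℝ × 𝔅.E) (L : ℕ) (s : YMSpecies G) (f : 𝓢(EuclideanSpace ℝ (Fin 4), ℝ)) :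
    Measurable (𝔅.obs p L s f) :=
  Finset.measurable_sum _ fun y _ => 𝔅.measurable_obsAt p L s f y

/-- (s1) restated through `obs` and `gibbs`. [folklore] -/
theorem expect_two_sub_cov_le' {γ : ℝ} (hγ : 0 < γ) (σ : Fin 2 → YMSpecies G)
    {f f' : 𝓢(EuclideanSpace ℝ (Fin 4), ℝ)} (hf : IsTimeCompact f) (hf' : IsTimeCompact f') :
    ∃ K : ℝ, ∃ T₁ : ℕ, ∀ p ∈ 𝔅.chart, γ ≤ p.1 → ∀ T : ℕ, T₁ ≤ T → ∀ t : ℕ, 1 ≤ t → t ≤ T →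
      |𝔅.expect p (2 * T + 1) 2 σ ![f, timeShiftTest 4 (t : ℝ) f'] -
        cov[𝔅.obs p T (σ 0) f, 𝔅.obs p T (σ 1) (timeShiftTest 4 (t : ℝ) f'); 𝔅.gibbs p (2 * T + 1)]|
        ≤ K * Real.exp (-(𝔅.fluctRate * t)) :=
  𝔅.expect_two_sub_cov_le γ hγ σ f f' hf hf'

/-- (s2) restated through `gibbs` and the step `F`. [folklore] -/
theorem gibbs_step' {p : ℝ × 𝔅.E} (hp : p ∈ 𝔅.chart) (hp0 : 0 < p.1) (S : ℕ) [NeZero S]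
    [NeZero (M * S)] :
    (𝔅.gibbs p (M * S)).map (𝔅.blockAvg S) = 𝔅.gibbs (𝔅.F p) S := by
  obtain ⟨hg, hy⟩ := (𝔅.mem_chart_iff p).1 hp
  exact 𝔅.gibbs_step p.1 p.2 ⟨hp0, hg.2⟩ hy S

/-- (s3) restated: the specification at a Wilson point is the Gibbsian specification of Wilson's
interaction at `β(g)`. [folklore] -/
theorem spec_wilson {g : ℝ} (hg : g ∈ Set.Ioc 0 𝔅.g₀) (S : ℕ) [NeZero S] :
    𝔅.spec (g, 𝔅.yW g) S = torusSpecOfPotential (wilsonTorusPotential r (𝔅.betaOf g) S) := by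
  rw [spec, 𝔅.potential_wilson g hg S]

/-- (s3) for the torus Gibbs measures. [folklore] -/
theorem gibbs_wilson {g : ℝ} (hg : g ∈ Set.Ioc 0 𝔅.g₀) (S : ℕ) [NeZero S] :
    𝔅.gibbs (g, 𝔅.yW g) S = torusGibbsOfPotential (wilsonTorusPotential r (𝔅.betaOf g) S) := by
  rw [gibbs, 𝔅.potential_wilson g hg S]

/-- **At Wilson points `obs` IS the tree's centred unit-lattice smeared field** of
`wilsonCentredSchwinger`: `obs (g, yW g) L s f U = smearedLatticeField s.F (box 4 L) 1 (c g s)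
⟨s⟩_{β(g),2L+1} f Ũ`. [folklore] -/
theorem obs_wilson {g : ℝ} (hg : g ∈ Set.Ioc 0 𝔅.g₀) (L : ℕ) (s : YMSpecies G)
    (f : 𝓢(EuclideanSpace ℝ (Fin 4), ℝ)) (U : GaugeConfig 4 (2 * L + 1) G) :
    𝔅.obs (g, 𝔅.yW g) L s f U =
      smearedLatticeField s.F (box 4 L) 1 (𝔅.c g s) (wilsonTorusMean r.ρ (𝔅.betaOf g) L s.F) f
        (torusLift (2 * L + 1) U) := by
  simp only [obs_apply, 𝔅.obsAt_wilson g hg L s f, smearedLatticeField, one_pow, mul_one, one_smul,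
    Finset.mul_sum]

/-- The block pieces at a chart point with coupling `≥ γ` are bounded by `B` times any local bound
of `|f|` around the block (first half of `obsAt_bound`). [folklore] -/
theorem abs_obsAt_le {γ : ℝ} (hγ : 0 < γ) (s : YMSpecies G) :
    ∃ B : ℝ, ∀ p ∈ 𝔅.chart, γ ≤ p.1 → ∀ (L : ℕ) (f : 𝓢(EuclideanSpace ℝ (Fin 4), ℝ))
      (y : Literature.Probability.LatticeModels.Site 4) (C : ℝ),
      (∀ u ∈ Metric.closedBall (siteToE y) 2, |f u| ≤ C) → ∀ U, |𝔅.obsAt p L s f y U| ≤ B * C := by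
  obtain ⟨B, hB⟩ := 𝔅.obsAt_bound γ hγ s
  exact ⟨B, fun p hp hγp L f y C hC => (hB p hp hγp L f y C hC).1⟩

end BalabanBlockSpecification

/-! ### 5. Well-formedness: the posited kernels are specifications, `gibbs` is their Gibbs measure -/

section WellFormed

variable {G : Type} [Group G] [TopologicalSpace G] [IsTopologicalGroup G] [CompactSpace G]
  [MeasurableSpace G] [BorelSpace G]

/-- **The Gibbsian specification of a bounded continuous adapted interaction on a torus is a
specification** in Georgii's sense (probability, outside-measurability, properness, consistency) —
the tree's `isSpecification_gibbsSpecOfPotential` on the finite site set `Edge 4 S` with product Haar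
measure, for a Hausdorff second-countable `G` (so that continuous terms are measurable). [cite: Georgii2011, Def. 2.9 with Def. 1.23] -/
theorem isSpecification_torusSpecOfPotential [T2Space G] [SecondCountableTopology G] {S : ℕ} [NeZero S]
    (Φ : Finset (Edge 4 S) → (GaugeConfig 4 S G →ᵇ ℝ))
    (hΦ : ∀ A, DependsOn (fun U : GaugeConfig 4 S G => Φ A U) (↑A : Set (Edge 4 S))) :
    IsSpecification (torusSpecOfPotential Φ) := by
  haveI : NeZero (haarProbability G) := ⟨IsProbabilityMeasure.ne_zero _⟩
  refine isSpecification_gibbsSpecOfPotential (haarProbability G) (fun A => ⟨hΦ A, ?_⟩)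
    (fun A => ⟨‖Φ A‖, fun U => ?_⟩) (supp := fun _ => Finset.univ) (fun Λ A _ _ => Finset.mem_univ A) 1
  · exact (Φ A).continuous.measurable
  · simpa [Real.norm_eq_abs] using (Φ A).norm_coe_le_norm U

/-- **On a finite torus the full-volume kernel is a Gibbs measure of the specification** (DLR by
consistency). [cite: Georgii2011, Def. 1.23 with Rem. 1.24] -/
theorem torusGibbsOfPotential_mem [T2Space G] [SecondCountableTopology G] {S : ℕ} [NeZero S]
    (Φ : Finset (Edge 4 S) → (GaugeConfig 4 S G →ᵇ ℝ))
    (hΦ : ∀ A, DependsOn (fun U : GaugeConfig 4 S G => Φ A U) (↑A : Set (Edge 4 S))) :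
    torusGibbsOfPotential Φ ∈ gibbsMeasures (torusSpecOfPotential Φ) := by
  have hγ := isSpecification_torusSpecOfPotential Φ hΦ
  exact ⟨hγ.isProbability _ _, fun Λ A hA => hγ.consistent (Finset.subset_univ Λ) 1 A hA⟩

/-- The torus Gibbs measure of an adapted interaction is a probability measure. [folklore] -/
theorem isProbabilityMeasure_torusGibbsOfPotential [T2Space G] [SecondCountableTopology G] {S : ℕ}
    [NeZero S] (Φ : Finset (Edge 4 S) → (GaugeConfig 4 S G →ᵇ ℝ))
    (hΦ : ∀ A, DependsOn (fun U : GaugeConfig 4 S G => Φ A U) (↑A : Set (Edge 4 S))) :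
    IsProbabilityMeasure (torusGibbsOfPotential Φ) :=
  (isSpecification_torusSpecOfPotential Φ hΦ).isProbability _ _

/-- Wilson's torus interaction generates a specification (non-vacuity of the vocabulary: (s3) pins an
honest specification). [cite: SeilerLNP1982, Ch. 2 (the Wilson action with boundary terms as a finite-range interaction)] -/
theorem isSpecification_torusSpecOfPotential_wilson [T2Space G] [SecondCountableTopology G]
    (r : LatticeRep G) (β : ℝ) (S : ℕ) [NeZero S] :
    IsSpecification (torusSpecOfPotential (wilsonTorusPotential r β S)) :=
  isSpecification_torusSpecOfPotential _ (dependsOn_wilsonTorusPotential r β S)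

/-- **(s3) pins the tree's Wilson theory**: the torus Gibbs measure of Wilson's interaction at `β`
IS Wave 0's `wilsonMeasure ρ β` (`Z⁻¹ e^{−β S_W} ∏ dHaar`): the Gibbsian kernel of the full volume
is product Haar tilted by `−β S_W`, and `Measure.tilted` normalises by the same partition function. [cite: Wilson1974] [cite: Georgii2011, Def. 2.9] -/
theorem torusGibbsOfPotential_wilsonTorusPotential [SecondCountableTopology G] (r : LatticeRep G)
    (β : ℝ) (S : ℕ) [NeZero S] :
    torusGibbsOfPotential (wilsonTorusPotential r β S) = wilsonMeasure (d := 4) (L := S) r.ρ β := by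
  classical
  have hH : (fun U : GaugeConfig 4 S G => -(1 : ℝ) * hamiltonianIn
      (fun A (U : GaugeConfig 4 S G) => wilsonTorusPotential r β S A U) (fun _ => Finset.univ)
        Finset.univ U) = fun U => -β * wilsonAction r.ρ U := by
    funext U; rw [hamiltonianIn_wilsonTorusPotential_univ]; ring
  have hSm : Measurable (wilsonAction (d := 4) (L := S) (G := G) r.ρ) :=
    measurable_wilsonAction r.ρ r.continuous
  obtain ⟨B, hB⟩ := exists_abs_wilsonAction_le (d := 4) (L := S) (G := G) r.ρ r.continuous
  have hφm : Measurable fun U : GaugeConfig 4 S G => -β * wilsonAction r.ρ U := hSm.const_mul _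
  have hφb : ∃ C, ∀ U : GaugeConfig 4 S G, |-β * wilsonAction r.ρ U| ≤ C :=
    ⟨|β| * B, fun U => by
      rw [abs_mul, abs_neg]; exact mul_le_mul_of_nonneg_left (hB U) (abs_nonneg _)⟩
  haveI : NeZero (haarProbability G) := ⟨IsProbabilityMeasure.ne_zero _⟩
  ext A hA
  rw [torusGibbsOfPotential, torusSpecOfPotential, gibbsSpecOfPotential, hH,
    ← lintegral_indicator_one hA,
    lintegral_tilted_map_glueWith_pi (haarProbability G) Finset.univ 1 hφm hφb
      (measurable_one.indicator hA)]
  simp only [lmarginal_univ]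
  rw [wilsonMeasure, Measure.smul_apply, smul_eq_mul, partitionFunction, wilsonWeight,
    withDensity_apply _ hA, withDensity_apply _ MeasurableSet.univ, Measure.restrict_univ,
    ENNReal.div_eq_inv_mul, ← lintegral_indicator hA]
  congr 1
  refine lintegral_congr fun U => ?_
  by_cases hU : U ∈ A <;> simp [hU]

omit [IsTopologicalGroup G] [MeasurableSpace G] [BorelSpace G] in
/-- A faithful continuous matrix representation makes `G` Hausdorff. [folklore] -/
theorem LatticeRep.t2Space (r : LatticeRep G) : T2Space G :=
  (r.continuous.isClosedEmbedding r.injective).isEmbedding.t2Space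

omit [IsTopologicalGroup G] [MeasurableSpace G] [BorelSpace G] in
/-- A faithful continuous matrix representation makes the compact group second countable. [folklore] -/
theorem LatticeRep.secondCountableTopology (r : LatticeRep G) : SecondCountableTopology G :=
  (r.continuous.isClosedEmbedding r.injective).isEmbedding.secondCountableTopology

namespace BalabanBlockSpecification

variable {r : LatticeRep G} {M : ℕ} (𝔅 : BalabanBlockSpecification G r M)

/-- **The posited kernels form a specification** for every chart point and torus. [cite: Georgii2011, Def. 2.9 with Def. 1.23] -/
theorem isSpecification_spec (p : ℝ × 𝔅.E) (S : ℕ) [NeZero S] : IsSpecification (𝔅.spec p S) := by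
  haveI := r.t2Space
  haveI := r.secondCountableTopology
  exact isSpecification_torusSpecOfPotential _ (𝔅.potential_dependsOn p S)

/-- **`gibbs p S` is a Gibbs measure of `spec p S`** (the torus Gibbs measure of the effective
theory). [cite: Georgii2011, Def. 1.23 with Rem. 1.24] -/
theorem gibbs_mem_gibbsMeasures (p : ℝ × 𝔅.E) (S : ℕ) [NeZero S] :
    𝔅.gibbs p S ∈ gibbsMeasures (𝔅.spec p S) := by
  haveI := r.t2Space
  haveI := r.secondCountableTopology
  exact torusGibbsOfPotential_mem _ (𝔅.potential_dependsOn p S)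

/-- **At the Wilson points the torus Gibbs measure of the effective theory IS Wilson's lattice
gauge theory of the tree** at inverse coupling `β(g)`. [cite: Wilson1974] -/
theorem gibbs_wilson_eq_wilsonMeasure {g : ℝ} (hg : g ∈ Set.Ioc 0 𝔅.g₀) (S : ℕ) [NeZero S] :
    𝔅.gibbs (g, 𝔅.yW g) S = wilsonMeasure (d := 4) (L := S) r.ρ (𝔅.betaOf g) := by
  haveI := r.secondCountableTopology
  rw [𝔅.gibbs_wilson hg S, torusGibbsOfPotential_wilsonTorusPotential]

/-- **(s1) is an exact moment identity at the Wilson points**: there `expect` IS the family of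
joint moments of the block representatives `obs` under the torus Gibbs measure `gibbs` (by (4b),
(s3), `obs_wilson` and `gibbs_wilson_eq_wilsonMeasure`), for every `n`. [folklore] -/
theorem expect_wilson_eq_integral_prod_obs {g : ℝ} (hg : g ∈ Set.Ioc 0 𝔅.g₀) (L n : ℕ)
    (σ : Fin n → YMSpecies G) (f : Fin n → 𝓢(EuclideanSpace ℝ (Fin 4), ℝ)) :
    𝔅.expect (g, 𝔅.yW g) (2 * L + 1) n σ f =
      ∫ U, ∏ i, 𝔅.obs (g, 𝔅.yW g) L (σ i) (f i) U ∂(𝔅.gibbs (g, 𝔅.yW g) (2 * L + 1)) := by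
  rw [𝔅.expect_wilson g hg L n σ f, 𝔅.gibbs_wilson_eq_wilsonMeasure hg, wilsonCentredSchwinger]
  simp only [𝔅.obs_wilson hg]

/-- `gibbs p S` is a probability measure. [folklore] -/
instance isProbabilityMeasure_gibbs (p : ℝ × 𝔅.E) (S : ℕ) [NeZero S] :
    IsProbabilityMeasure (𝔅.gibbs p S) :=
  (𝔅.gibbs_mem_gibbsMeasures p S).isProbabilityMeasure

end BalabanBlockSpecification

end WellFormed

end Literature.MathematicalPhysics.QuantumFieldTheory

end
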